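import Summits.SmoothPoincare4.SmoothPoincare4.Theorems.InformationMetricHadamardAhHadamardFillingStubCompactificationCollarAux
import Summits.SmoothPoincare4.SmoothPoincare4.Theorems.InformationMetricHadamardAhHadamardFillingStubInteriorConnected
import Summits.SmoothPoincare4.SmoothPoincare4.Theorems.InformationMetricHadamardAhHadamardFillingStubFiniteFrame
import Summits.SmoothPoincare4.SmoothPoincare4.Theorems.InformationMetricHadamardAhHadamardFillingStubBaseMotion
import Summits.SmoothPoincare4.SmoothPoincare4.Theorems.InformationMetricHadamardAhHadamardFillingStubCollarGermInjOpen
import Summits.SmoothPoincare4.SmoothPoincare4.Theorems.InformationMetricHadamardAhHadamardFillingStubHadamardQuotient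
import Summits.SmoothPoincare4.SmoothPoincare4.Theorems.InformationMetricHadamardAhHadamardFillingStubVerticalUnitField
import Summits.SmoothPoincare4.SmoothPoincare4.Theorems.InformationMetricHadamardAhHadamardFillingStubNormalPairPointwise
import Summits.SmoothPoincare4.SmoothPoincare4.Theorems.InformationMetricHadamardAhHadamardFillingStubSmoothingFamily
import Summits.SmoothPoincare4.SmoothPoincare4.Theorems.InformationMetricHadamardAhHadamardFillingStubNormalPairContinuous
import Literature.Topology.FourManifolds.OpenCollarExistence
import Literature.Geometry.Manifold.SmoothEmbeddingInverse

/-!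
# Stub `stub_compactificationCollar` (crux `AhHadamardFilling`, line `einstein-bulk-transfer`)

**The compactification collar** — the owned statement of the line, assembled from the landed
worker stubs. For the `C²` conformal-compactification package of a 5-manifold `(N, g)` over the
closed 4-manifold `(M, g₀)` (compact connected `X̄` with boundary, `j : N ≅ int X̄`,
`ι : M ≅ ∂X̄`, smooth bdf `ρ` with `|dρ|_ḡ = 1` on `∂X̄`, a `C²` metric `ḡ` with `j^*ḡ = ρ² g`
and `ι^*ḡ = φ g₀`), `N` is connected and carries a smooth injective end collar
`Φ : M × (0,1) → N` with co-compact far parts on which `g` is `C⁰`-conical over `κ₀ g₀`: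
`|g(dΦ(v,s), dΦ(v,s)) - (s² + κ₀ g₀(v,v))/λ²| ≤ ε (s² + κ₀ g₀(v,v))/λ²` for `λ < t(ε)`.

Construction. `b = ⟨M, ι⟩` is a boundary datum of `X̄`, `D` its open collar
(`BoundaryData.nonempty_openCollar`), `κ = uncurry D.toFun`. The normal pair `(z, θ)`
(`stub_normalPairPointwise`, continuous by `stub_normalPairContinuous`), the frame
(`stub_finiteFrame`), the smoothing families of `θ` and of the coefficients of `z`
(`stub_smoothingFamily`) and the base motion (`stub_baseMotion`) give the `C¹` collar germ
`Ψ = (F, λ U_θ)` with `dΨ_{(x,0)}(v,s) = (v + s z, s θ)`; `stub_collarGermInjOpen` makes it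
injective with open band-swallowing images on `M × (0, l₁)`; `Φ(x,λ) = j⁻¹ κ Ψ(x, l₁λ)`
(`κ₀ = 1/l₁²`). The metric identity `g(dΦ w, dΦ w) = ḡ(dκ dΨ w', ·)/ρ²`
(`helper_innerMfderivInteriorInverse`), `ρ ∘ κ = t·r` (`stub_hadamardQuotient`) and the uniform cone
estimate of the germ (`helper_coneEstimateOfGerm`, from `stub_uniformCone`) give the asymptotics.
-/

noncomputable section

-- the prescribed namespace `Summit.<P>.<Sub>.…` duplicates `SmoothPoincare4` (P = Sub)
set_option linter.dupNamespace false

open scoped Manifold ContDiff Topology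
open Set Function Bundle
open Literature.Topology.FourManifolds Literature.Geometry.Lorentzian

namespace Summit.SmoothPoincare4.SmoothPoincare4.Cruxes.AhHadamardFilling.EinsteinBulkTransfer

/-- Arithmetic of the rescaling `λ ↦ l₁ λ`: `(s² + G/l₁²)/l² = ((l₁ s)² + G)/(l₁ l)²`. -/
theorem rescale_identity {l₁ l s : ℝ} (G : ℝ) (hl₁ : l₁ ≠ 0) (hl : l ≠ 0) :
    (1 : ℝ) * (s ^ 2 + 1 / l₁ ^ 2 * G) / l ^ 2 = ((l₁ * s) ^ 2 + G) / (l₁ * l) ^ 2 := by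
  rw [div_eq_div_iff (pow_ne_zero 2 hl) (pow_ne_zero 2 (mul_ne_zero hl₁ hl))]
  field_simp

/-- Arithmetic of the rescaling: `B / (a u)² = B / u² / a²`. -/
theorem div_mul_sq (B a u : ℝ) : B / (a * u) ^ 2 = B / u ^ 2 / a ^ 2 := by
  rw [mul_pow, mul_comm, div_div]

/-- **Compactification collar** (registered stub `stub_compactificationCollar` of line
`einstein-bulk-transfer`, tree-level form). For the `C²` conformal-compactification package of
`(N, g)` over the closed 4-manifold `(M, g₀)`, `N` is connected and there is a smooth injective
end collar `Φ : M × (0,1) → N` with co-compact far parts on which `g` is `C⁰`-conical over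
`κ₀ g₀` (`c = 1`, `κ₀ = 1/l₁²`). [cite: Hirsch1976, Thm 4.6.1] -/
theorem stub_compactificationCollar
    (M : Type) [TopologicalSpace M] [T2Space M] [SecondCountableTopology M]
    [ChartedSpace (EuclideanSpace ℝ (Fin 4)) M] [IsManifold (𝓡 4) ∞ M] [CompactSpace M]
    (g₀ : Bundle.ContMDiffRiemannianMetric (𝓡 4) ∞ (EuclideanSpace ℝ (Fin 4))
      (TangentSpace (𝓡 4) : M → Type _))
    (N : Type) [TopologicalSpace N] [T2Space N] [SecondCountableTopology N]
    [ChartedSpace (EuclideanSpace ℝ (Fin 5)) N] [IsManifold (𝓡 5) ∞ N]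
    (g : Bundle.ContMDiffRiemannianMetric (𝓡 5) ∞ (EuclideanSpace ℝ (Fin 5))
      (TangentSpace (𝓡 5) : N → Type _))
    (hpack : ∃ (X : Type) (_ : TopologicalSpace X) (_ : T2Space X) (_ : SecondCountableTopology X)
      (_ : ChartedSpace (EuclideanHalfSpace 5) X) (_ : IsManifold (𝓡∂ 5) ∞ X) (_ : CompactSpace X)
      (_ : ConnectedSpace X) (j : N → X) (ι : M → X) (ρ : X → ℝ)
      (gb : Bundle.ContMDiffRiemannianMetric (𝓡∂ 5) 2 (EuclideanSpace ℝ (Fin 5))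
        (TangentSpace (𝓡∂ 5) : X → Type _)),
      Manifold.IsSmoothEmbedding (𝓡 5) (𝓡∂ 5) ∞ j ∧ Set.range j = (𝓡∂ 5).interior X ∧
      Manifold.IsSmoothEmbedding (𝓡 4) (𝓡∂ 5) ∞ ι ∧ Set.range ι = (𝓡∂ 5).boundary X ∧
      ContMDiff (𝓡∂ 5) 𝓘(ℝ, ℝ) ∞ ρ ∧ (∀ x : X, 0 ≤ ρ x) ∧
      (∀ x : X, ρ x = 0 ↔ x ∈ (𝓡∂ 5).boundary X) ∧
      (∀ y : M, ∃ ν : TangentSpace (𝓡∂ 5) (ι y), gb.inner (ι y) ν ν = 1 ∧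
        ∀ v : TangentSpace (𝓡∂ 5) (ι y), gb.inner (ι y) ν v = mfderiv (𝓡∂ 5) 𝓘(ℝ, ℝ) ρ (ι y) v) ∧
      (∀ (x : N) (v w : TangentSpace (𝓡 5) x),
        gb.inner (j x) (mfderiv (𝓡 5) (𝓡∂ 5) j x v) (mfderiv (𝓡 5) (𝓡∂ 5) j x w) =
          ρ (j x) ^ 2 * g.inner x v w) ∧
      (∃ φ : M → ℝ, ∀ y : M, 0 < φ y ∧ ∀ v w : TangentSpace (𝓡 4) y,
        gb.inner (ι y) (mfderiv (𝓡 4) (𝓡∂ 5) ι y v) (mfderiv (𝓡 4) (𝓡∂ 5) ι y w) =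
          φ y * g₀.inner y v w)) :
    ConnectedSpace N ∧
    ∃ (c κ₀ : ℝ) (Φ : M × ℝ → N), 0 < c ∧ 0 < κ₀ ∧
      ContMDiffOn ((𝓡 4).prod 𝓘(ℝ, ℝ)) (𝓡 5) ∞ Φ (univ ×ˢ Ioo (0 : ℝ) 1) ∧
      InjOn Φ (univ ×ˢ Ioo (0 : ℝ) 1) ∧
      (∀ t ∈ Ioo (0 : ℝ) 1, IsCompact (Φ '' (univ ×ˢ Ioo (0 : ℝ) t))ᶜ) ∧
      (∀ ε : ℝ, 0 < ε → ∃ t ∈ Ioo (0 : ℝ) 1, ∀ (x : M) (l : ℝ), l ∈ Ioo (0 : ℝ) t →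
        ∀ (v : TangentSpace (𝓡 4) x) (s : ℝ),
          |g.inner (Φ (x, l))
                (mfderiv ((𝓡 4).prod 𝓘(ℝ, ℝ)) (𝓡 5) Φ (x, l) (v, s))
                (mfderiv ((𝓡 4).prod 𝓘(ℝ, ℝ)) (𝓡 5) Φ (x, l) (v, s)) -
              c * (s ^ 2 + κ₀ * g₀.inner x v v) / l ^ 2|
            ≤ ε * (c * (s ^ 2 + κ₀ * g₀.inner x v v) / l ^ 2)) := by
  obtain ⟨X, _, _, _, _, _, _, _, j, ι, ρ, gb, hj, hjr, hι, hιr, hρ, hρ0, hρb, hν, hjg, φ, hφ⟩ :=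
    hpack
  /- ### `N ≅ int X̄` is nonempty and connected -/
  have hNne : Nonempty N := by
    -- the interior of the compact `X̄` is dense, in particular nonempty
    have hdense : Dense ((𝓡∂ 5).interior X) := by
      rcases isEmpty_or_nonempty M with hM | hM
      · rw [← ModelWithCorners.compl_boundary, ← hιr, Set.range_eq_empty_iff.2 hM, compl_empty]
        exact dense_univ
      · obtain ⟨D⟩ := (BoundaryData.nonempty_openCollar
          (b := (⟨M, ι, hι, hιr⟩ : BoundaryData (𝓡∂ 5) X (𝓡 4))) : Nonempty _)
        exact dense_interior_of_openCollar D
    obtain ⟨w, hw⟩ := hdense.nonempty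
    rw [← hjr] at hw
    obtain ⟨y, -⟩ := hw
    exact ⟨y⟩
  have hconn : ConnectedSpace N := by
    have hpre : IsPreconnected (range j) := hjr ▸ stub_interiorConnected X
    rw [← Set.image_univ, hj.isEmbedding.isInducing.isPreconnected_image] at hpre
    haveI := hNne
    exact connectedSpace_iff_univ.2 ⟨univ_nonempty, hpre⟩
  refine ⟨hconn, ?_⟩
  haveI := hNne
  /- ### The degenerate case `M = ∅` (no boundary): any `Φ`, the far complement is `N ≅ X̄` -/
  rcases isEmpty_or_nonempty M with hM | hM
  · have huc : IsCompact (univ : Set N) := by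
      refine (hj.isEmbedding.isInducing.isCompact_iff).2 ?_
      rw [image_univ, hjr, ← ModelWithCorners.compl_boundary, ← hιr,
        Set.range_eq_empty_iff.2 hM, compl_empty]
      exact isCompact_univ
    refine ⟨1, 1, fun _ => Classical.arbitrary N, one_pos, one_pos, contMDiffOn_const, ?_, ?_, ?_⟩
    · rintro ⟨x, _⟩
      exact (IsEmpty.false x).elim
    · intro t _
      have he : (fun _ : M × ℝ => Classical.arbitrary N) '' ((univ : Set M) ×ˢ Ioo (0 : ℝ) t) = ∅ := by
        rw [Set.image_eq_empty]
        ext ⟨x, _⟩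
        exact (IsEmpty.false x).elim
      rw [he, compl_empty]
      exact huc
    · intro ε _
      exact ⟨1 / 2, by norm_num, fun x => (IsEmpty.false x).elim⟩
  /- ### The open collar of `X̄` along the boundary datum `⟨M, ι⟩` -/
  obtain ⟨D⟩ := (BoundaryData.nonempty_openCollar
    (b := (⟨M, ι, hι, hιr⟩ : BoundaryData (𝓡∂ 5) X (𝓡 4))) : Nonempty _)
  have hκS : ContMDiffOn ((𝓡 4).prod 𝓘(ℝ, ℝ)) (𝓡∂ 5) ∞ (uncurry D.toFun)
      ((univ : Set M) ×ˢ Ici (0 : ℝ)) := D.contMDiffOn_toFun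
  have hκ0 : ∀ x : M, uncurry D.toFun (x, 0) = ι x := fun x => D.apply_zero x
  have hS01 : (univ : Set M) ×ˢ Ioi (0 : ℝ) ⊆ (univ : Set M) ×ˢ Ici (0 : ℝ) :=
    prod_mono le_rfl Ioi_subset_Ici_self
  -- positive collar parameters give interior points, i.e. points of `range j`
  have hκj : ∀ q ∈ (univ : Set M) ×ˢ Ioi (0 : ℝ), uncurry D.toFun q ∈ range j := by
    rintro ⟨x, t⟩ ⟨-, ht⟩
    rw [hjr]
    exact D.isInteriorPoint_apply x ht
  have hκρ : ∀ q ∈ (univ : Set M) ×ˢ Ioi (0 : ℝ), ρ (uncurry D.toFun q) ≠ 0 := by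
    rintro ⟨x, t⟩ ⟨-, ht⟩
    rw [Ne, hρb]
    exact ((𝓡∂ 5).isInteriorPoint_iff_not_isBoundaryPoint _).1 (D.isInteriorPoint_apply x ht)
  /- ### The normal pair and its continuity -/
  have hP := fun x => stub_normalPairPointwise M g₀ X ι hι hιr ρ hρ hρ0 hρb gb hν φ hφ D x
  have ha₀ : ∀ x : M, 0 < derivWithin (fun t => ρ (D.toFun x t)) (Ici 0) 0 := fun x => (hP x).1
  choose z θ hθ hzθ using fun x => (hP x).2
  obtain ⟨hθc, hzc⟩ := stub_normalPairContinuous M g₀ X ι hι hιr ρ hρ gb φ hφ D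
    (stub_verticalUnitField M) ha₀ z θ hθ hzθ
  /- ### Frame, smoothing families, base motion -/
  obtain ⟨m, Y, hY, hdec⟩ := stub_finiteFrame M
  obtain ⟨c, hc, hzc'⟩ := hdec z hzc
  choose U _hUc _hU0 hUs hU1 hUd using fun i => stub_smoothingFamily M (c i) (hc i)
  obtain ⟨Uθ, hUθc, hUθ0, hUθs, hUθ1, hUθd⟩ := stub_smoothingFamily M θ hθc
  have hVs : ∀ i, ContMDiffOn ((𝓡 4).prod 𝓘(ℝ, ℝ)) 𝓘(ℝ, ℝ) ∞ (fun p : M × ℝ => p.2 * U i p)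
      (univ ×ˢ {0}ᶜ) := fun i => contMDiffOn_snd.mul (hUs i)
  obtain ⟨F, hF1, hFs, hF0, hFd⟩ := stub_baseMotion M m Y hY c (fun i p => p.2 * U i p) hU1
    hVs (fun i x => by simp) hUd
  /- ### The collar germ `Ψ = (F, λ U_θ)` -/
  obtain ⟨Ψ, hΨdef⟩ : ∃ Ψ : M × ℝ → M × ℝ, Ψ = fun p => (F p, p.2 * Uθ p) := ⟨_, rfl⟩
  have hΨ2 : ∀ p : M × ℝ, (Ψ p).2 = p.2 * Uθ p := fun p => by rw [hΨdef]
  have hΨ1 : ContMDiff ((𝓡 4).prod 𝓘(ℝ, ℝ)) ((𝓡 4).prod 𝓘(ℝ, ℝ)) 1 Ψ := by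
    rw [hΨdef]
    exact hF1.prodMk hUθ1
  have hΨs : ContMDiffOn ((𝓡 4).prod 𝓘(ℝ, ℝ)) ((𝓡 4).prod 𝓘(ℝ, ℝ)) ∞ Ψ (univ ×ˢ {0}ᶜ) := by
    rw [hΨdef]
    exact hFs.prodMk (contMDiffOn_snd.mul hUθs)
  have hΨ0 : ∀ x : M, Ψ (x, 0) = (x, 0) := fun x => by
    rw [hΨdef]
    simp only [hF0, zero_mul]
  have hΨd : ∀ (x : M) (v : TangentSpace (𝓡 4) x) (s : ℝ),
      mfderiv ((𝓡 4).prod 𝓘(ℝ, ℝ)) ((𝓡 4).prod 𝓘(ℝ, ℝ)) Ψ (x, 0) (v, s) =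
        (v + s • z x, s * θ x) := by
    intro x v s
    have hdF : MDifferentiableAt ((𝓡 4).prod 𝓘(ℝ, ℝ)) (𝓡 4) F (x, 0) :=
      hF1.mdifferentiableAt one_ne_zero
    have hdT : MDifferentiableAt ((𝓡 4).prod 𝓘(ℝ, ℝ)) 𝓘(ℝ, ℝ) (fun p : M × ℝ => p.2 * Uθ p)
        (x, 0) := hUθ1.mdifferentiableAt one_ne_zero
    rw [hΨdef, mfderiv_prodMk hdF hdT]
    change (mfderiv ((𝓡 4).prod 𝓘(ℝ, ℝ)) (𝓡 4) F (x, 0) (v, s),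
      mfderiv ((𝓡 4).prod 𝓘(ℝ, ℝ)) 𝓘(ℝ, ℝ) (fun p : M × ℝ => p.2 * Uθ p) (x, 0) (v, s)) =
      ((v + s • z x, s * θ x) : TangentSpace (𝓡 4) x × ℝ)
    rw [hFd, hUθd, hzc' x]
    rfl
  have hinj : ∀ x : M,
      Injective (mfderiv ((𝓡 4).prod 𝓘(ℝ, ℝ)) ((𝓡 4).prod 𝓘(ℝ, ℝ)) Ψ (x, 0)) := by
    intro x w₁ w₂ h
    obtain ⟨v₁, s₁⟩ := w₁
    obtain ⟨v₂, s₂⟩ := w₂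
    rw [hΨd x v₁ s₁, hΨd x v₂ s₂] at h
    obtain ⟨hv, hs⟩ := Prod.mk.inj h
    have hs' : s₁ = s₂ := mul_right_cancel₀ (hθ x).ne' hs
    subst hs'
    have h2 := congrArg (fun w : TangentSpace (𝓡 4) x => w - s₁ • z x) hv
    simp only [add_sub_cancel_right] at h2
    exact congrArg₂ Prod.mk h2 rfl
  have hpos : ∀ x : M, 0 < (mfderiv ((𝓡 4).prod 𝓘(ℝ, ℝ)) ((𝓡 4).prod 𝓘(ℝ, ℝ)) Ψ (x, 0)
      ((0 : TangentSpace (𝓡 4) x), (1 : ℝ))).2 := by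
    intro x
    rw [hΨd]
    simpa using hθ x
  obtain ⟨l₁, hl₁, hinjOn, hposT, hopen, hband⟩ :=
    stub_collarGermInjOpen M Ψ hΨ1 hΨs hΨ0 hinj hpos
  have hΨpos : ∀ q ∈ (univ : Set M) ×ˢ Ioo (0 : ℝ) l₁, Ψ q ∈ (univ : Set M) ×ˢ Ioi (0 : ℝ) :=
    fun q hq => ⟨mem_univ _, hposT q hq⟩
  /- ### Hadamard quotient `ρ ∘ κ = t · r` -/
  obtain ⟨r, hrc, hr, hr0⟩ := stub_hadamardQuotient M (fun p => ρ (uncurry D.toFun p))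
    (hρ.comp_contMDiffOn hκS) (fun x => by
      show ρ (uncurry D.toFun (x, 0)) = 0
      rw [hκ0, hρb, ← hιr]
      exact mem_range_self x)
  have hr0' : ∀ x : M, 0 < r (x, 0) := fun x => (hr0 x).symm ▸ ha₀ x
  -- the quadratic identity of the normal pair in terms of `κ (x, 0)` and `r (x, 0)`
  have hzθ' : ∀ (x : M) (v : TangentSpace (𝓡 4) x) (s : ℝ),
      gb.inner (uncurry D.toFun (x, 0))
          (mfderivWithin ((𝓡 4).prod 𝓘(ℝ, ℝ)) (𝓡∂ 5) (uncurry D.toFun) (univ ×ˢ Ici 0) (x, 0)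
            (v + s • z x, s * θ x))
          (mfderivWithin ((𝓡 4).prod 𝓘(ℝ, ℝ)) (𝓡∂ 5) (uncurry D.toFun) (univ ×ˢ Ici 0) (x, 0)
            (v + s • z x, s * θ x)) =
        (θ x * r (x, 0)) ^ 2 * (s ^ 2 + g₀.inner x v v) := by
    intro x v s
    rw [hr0 x, hκ0 x]
    exact hzθ x v s
  -- the uniform cone estimate for the germ
  have hE := helper_coneEstimateOfGerm D g₀ gb Ψ hΨ1 hΨ0 Uθ hUθc hΨ2 θ hθ hUθ0 z hΨd r hrc hr0' hzθ'
  /- ### The collar `Φ (x, l) = j⁻¹ (κ (Ψ (x, l₁ l)))` -/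
  obtain ⟨P, hPdef⟩ : ∃ P : M × ℝ → N, P = fun q => invFun j (uncurry D.toFun q) := ⟨_, rfl⟩
  have hjP : ∀ q ∈ (univ : Set M) ×ˢ Ioi (0 : ℝ), j (P q) = uncurry D.toFun q := fun q hq => by
    rw [hPdef]
    exact invFun_eq (hκj q hq)
  have hPs : ContMDiffOn ((𝓡 4).prod 𝓘(ℝ, ℝ)) (𝓡 5) ∞ P ((univ : Set M) ×ˢ Ioi (0 : ℝ)) := by
    rw [hPdef]
    exact (Literature.Geometry.Manifold.contMDiffOn_invFun_range hj).comp (hκS.mono hS01) hκj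
  have hsc1 : ∀ (y : M) (l : ℝ), l ∈ Ioo (0 : ℝ) 1 → (y, l₁ * l) ∈ (univ : Set M) ×ˢ Ioo (0 : ℝ) l₁ := by
    intro y l hl
    refine ⟨mem_univ _, mul_pos hl₁ hl.1, ?_⟩
    show l₁ * l < l₁
    nlinarith [hl.2]
  obtain ⟨Φ, hΦdef⟩ : ∃ Φ : M × ℝ → N, Φ = fun p => P (Ψ (p.1, l₁ * p.2)) := ⟨_, rfl⟩
  have hΦmk : ∀ (y : M) (l : ℝ), Φ (y, l) = P (Ψ (y, l₁ * l)) := fun y l => by rw [hΦdef]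
  -- (1) smoothness
  have hΦsm : ContMDiffOn ((𝓡 4).prod 𝓘(ℝ, ℝ)) (𝓡 5) ∞ Φ ((univ : Set M) ×ˢ Ioo (0 : ℝ) 1) := by
    have h0 : ContMDiff ((𝓡 4).prod 𝓘(ℝ, ℝ)) ((𝓡 4).prod 𝓘(ℝ, ℝ)) ∞
        (fun p : M × ℝ => ((p.1, l₁ * p.2) : M × ℝ)) :=
      contMDiff_fst.prodMk (contMDiff_const.mul contMDiff_snd)
    have h1 : ContMDiffOn ((𝓡 4).prod 𝓘(ℝ, ℝ)) ((𝓡 4).prod 𝓘(ℝ, ℝ)) ∞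
        (fun p : M × ℝ => Ψ (p.1, l₁ * p.2)) ((univ : Set M) ×ˢ Ioo (0 : ℝ) 1) := by
      refine hΨs.comp h0.contMDiffOn ?_
      rintro ⟨y, l⟩ ⟨-, hl0, -⟩
      exact ⟨mem_univ _, (mul_pos hl₁ hl0).ne'⟩
    rw [hΦdef]
    refine hPs.comp h1 ?_
    rintro ⟨y, l⟩ ⟨-, hl⟩
    exact hΨpos _ (hsc1 y l hl)
  -- (2) injectivity
  have hΦinj : InjOn Φ ((univ : Set M) ×ˢ Ioo (0 : ℝ) 1) := by
    rintro ⟨y, l⟩ ⟨-, hl⟩ ⟨y', l'⟩ ⟨-, hl'⟩ h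
    have hm := hsc1 y l hl
    have hm' := hsc1 y' l' hl'
    rw [hΦmk, hΦmk] at h
    have h1 : uncurry D.toFun (Ψ (y, l₁ * l)) = uncurry D.toFun (Ψ (y', l₁ * l')) := by
      rw [← hjP _ (hΨpos _ hm), ← hjP _ (hΨpos _ hm')]
      exact congrArg j h
    have h2 : Ψ (y, l₁ * l) = Ψ (y', l₁ * l') :=
      injOn_uncurry_toFun D (hS01 (hΨpos _ hm)) (hS01 (hΨpos _ hm')) h1
    have h3 : ((y, l₁ * l) : M × ℝ) = (y', l₁ * l') := by
      refine hinjOn ⟨mem_univ _, ?_, hm.2.2⟩ ⟨mem_univ _, ?_, hm'.2.2⟩ h2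
      · exact (neg_lt_zero.2 hl₁).trans hm.2.1
      · exact (neg_lt_zero.2 hl₁).trans hm'.2.1
    obtain ⟨h4, h5⟩ := Prod.mk.inj h3
    rw [h4, mul_left_cancel₀ hl₁.ne' h5]
  -- (3) co-compact far parts
  have hΦco : ∀ t ∈ Ioo (0 : ℝ) 1, IsCompact (Φ '' ((univ : Set M) ×ˢ Ioo (0 : ℝ) t))ᶜ := by
    intro t ht
    have hl₁t : l₁ * t ∈ Ioc (0 : ℝ) l₁ := ⟨mul_pos hl₁ ht.1, mul_le_of_le_one_right hl₁.le ht.2.le⟩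
    have hO'l : (univ : Set M) ×ˢ Ioo (0 : ℝ) (l₁ * t) ⊆ (univ : Set M) ×ˢ Ioo (0 : ℝ) l₁ :=
      prod_mono le_rfl (Ioo_subset_Ioo_right hl₁t.2)
    have hscO' : ∀ p ∈ (univ : Set M) ×ˢ Ioo (0 : ℝ) t,
        ((p.1, l₁ * p.2) : M × ℝ) ∈ (univ : Set M) ×ˢ Ioo (0 : ℝ) (l₁ * t) := by
      rintro ⟨y, l⟩ ⟨-, hl0, hlt⟩
      exact ⟨mem_univ _, mul_pos hl₁ hl0, mul_lt_mul_of_pos_left hlt hl₁⟩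
    have himg : Φ '' ((univ : Set M) ×ˢ Ioo (0 : ℝ) t) =
        j ⁻¹' (uncurry D.toFun '' (Ψ '' ((univ : Set M) ×ˢ Ioo (0 : ℝ) (l₁ * t)))) := by
      ext n
      constructor
      · rintro ⟨⟨y, l⟩, hp, rfl⟩
        rw [mem_preimage, hΦmk, hjP _ (hΨpos _ (hO'l (hscO' _ hp)))]
        exact mem_image_of_mem _ (mem_image_of_mem _ (hscO' _ hp))
      · rintro ⟨_, ⟨⟨y, μ⟩, hq, rfl⟩, hn⟩
        obtain ⟨-, hμ0, hμt⟩ := hq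
        refine ⟨(y, μ / l₁), ⟨mem_univ _, div_pos hμ0 hl₁, ?_⟩, ?_⟩
        · rwa [div_lt_iff₀ hl₁, mul_comm]
        · apply hj.isEmbedding.injective
          rw [hΦmk, ← mul_div_assoc, mul_div_cancel_left₀ _ hl₁.ne',
            hjP _ (hΨpos _ (hO'l ⟨mem_univ _, hμ0, hμt⟩)), hn]
    rw [himg]
    obtain ⟨δ, hδ, hδband⟩ := hband (l₁ * t) hl₁t
    refine helper_isCompactComplPreimageImageCollar D j hj.isEmbedding hjr ?_ hδ hδband
    have hΨO'S : Ψ '' ((univ : Set M) ×ˢ Ioo (0 : ℝ) (l₁ * t)) ⊆ (univ : Set M) ×ˢ Ici (0 : ℝ) := by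
      rintro _ ⟨q, hq, rfl⟩
      exact hS01 (hΨpos _ (hO'l hq))
    have := isOpen_image_toFun_inter D (hopen (l₁ * t) hl₁t)
    rwa [inter_eq_left.2 hΨO'S] at this
  /- ### The metric identity `g(dΦ w, dΦ w) = Q / (l₁ l)²` at positive heights -/
  have hmetric : ∀ (x : M) (l : ℝ), l ∈ Ioo (0 : ℝ) 1 → ∀ (v : TangentSpace (𝓡 4) x) (s : ℝ),
      g.inner (Φ (x, l)) (mfderiv ((𝓡 4).prod 𝓘(ℝ, ℝ)) (𝓡 5) Φ (x, l) (v, s))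
          (mfderiv ((𝓡 4).prod 𝓘(ℝ, ℝ)) (𝓡 5) Φ (x, l) (v, s)) =
        gb.inner (uncurry D.toFun (Ψ (x, l₁ * l)))
            (mfderivWithin ((𝓡 4).prod 𝓘(ℝ, ℝ)) (𝓡∂ 5) (uncurry D.toFun) (univ ×ˢ Ici 0)
              (Ψ (x, l₁ * l))
              (mfderiv ((𝓡 4).prod 𝓘(ℝ, ℝ)) ((𝓡 4).prod 𝓘(ℝ, ℝ)) Ψ (x, l₁ * l) (v, l₁ * s)))
            (mfderivWithin ((𝓡 4).prod 𝓘(ℝ, ℝ)) (𝓡∂ 5) (uncurry D.toFun) (univ ×ˢ Ici 0)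
              (Ψ (x, l₁ * l))
              (mfderiv ((𝓡 4).prod 𝓘(ℝ, ℝ)) ((𝓡 4).prod 𝓘(ℝ, ℝ)) Ψ (x, l₁ * l) (v, l₁ * s))) /
          (Uθ (x, l₁ * l) * r (Ψ (x, l₁ * l))) ^ 2 / (l₁ * l) ^ 2 := by
    intro x l hl v s
    have hm : (x, l₁ * l) ∈ (univ : Set M) ×ˢ Ioo (0 : ℝ) l₁ := hsc1 x l hl
    have hy : Ψ (x, l₁ * l) ∈ (univ : Set M) ×ˢ Ioi (0 : ℝ) := hΨpos _ hm
    have hyS : (univ : Set M) ×ˢ Ioi (0 : ℝ) ∈ 𝓝 (Ψ (x, l₁ * l)) :=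
      (isOpen_univ.prod isOpen_Ioi).mem_nhds hy
    -- differentiability of the pieces
    have hdsc : HasMFDerivAt ((𝓡 4).prod 𝓘(ℝ, ℝ)) ((𝓡 4).prod 𝓘(ℝ, ℝ))
        (fun p : M × ℝ => ((p.1, l₁ * p.2) : M × ℝ)) (x, l)
        ((ContinuousLinearMap.fst ℝ (EuclideanSpace ℝ (Fin 4)) ℝ).prod
          (l₁ • ContinuousLinearMap.snd ℝ (EuclideanSpace ℝ (Fin 4)) ℝ)) := by
      have h1 : HasMFDerivAt ((𝓡 4).prod 𝓘(ℝ, ℝ)) (𝓡 4) (fun p : M × ℝ => p.1) (x, l)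
          (ContinuousLinearMap.fst ℝ (EuclideanSpace ℝ (Fin 4)) ℝ) := hasMFDerivAt_fst _
      have h2 : HasMFDerivAt ((𝓡 4).prod 𝓘(ℝ, ℝ)) 𝓘(ℝ, ℝ) (fun p : M × ℝ => l₁ * p.2) (x, l)
          (l₁ • ContinuousLinearMap.snd ℝ (EuclideanSpace ℝ (Fin 4)) ℝ) :=
        (hasMFDerivAt_snd (I := 𝓡 4) (I' := 𝓘(ℝ, ℝ)) (x, l)).const_smul l₁
      exact h1.prodMk h2
    have hdΨ : MDifferentiableAt ((𝓡 4).prod 𝓘(ℝ, ℝ)) ((𝓡 4).prod 𝓘(ℝ, ℝ)) Ψ (x, l₁ * l) :=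
      hΨ1.mdifferentiableAt one_ne_zero
    have hdP : MDifferentiableAt ((𝓡 4).prod 𝓘(ℝ, ℝ)) (𝓡 5) P (Ψ (x, l₁ * l)) :=
      (hPs.contMDiffAt hyS).mdifferentiableAt (by simp)
    -- `dΦ (v, s) = dP (dΨ (v, l₁ s))`
    have hdΦ : mfderiv ((𝓡 4).prod 𝓘(ℝ, ℝ)) (𝓡 5) Φ (x, l) (v, s) =
        mfderiv ((𝓡 4).prod 𝓘(ℝ, ℝ)) (𝓡 5) P (Ψ (x, l₁ * l))
          (mfderiv ((𝓡 4).prod 𝓘(ℝ, ℝ)) ((𝓡 4).prod 𝓘(ℝ, ℝ)) Ψ (x, l₁ * l) (v, l₁ * s)) := by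
      have hPΨ : MDifferentiableAt ((𝓡 4).prod 𝓘(ℝ, ℝ)) (𝓡 5) (P ∘ Ψ)
          ((fun p : M × ℝ => ((p.1, l₁ * p.2) : M × ℝ)) (x, l)) := hdP.comp _ hdΨ
      have e1 : Φ = (P ∘ Ψ) ∘ fun p : M × ℝ => ((p.1, l₁ * p.2) : M × ℝ) := by
        rw [hΦdef]; rfl
      rw [e1, mfderiv_comp (x, l) hPΨ hdsc.mdifferentiableAt, hdsc.mfderiv]
      show mfderiv ((𝓡 4).prod 𝓘(ℝ, ℝ)) (𝓡 5) (P ∘ Ψ) (x, l₁ * l) (v, l₁ * s) = _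
      rw [mfderiv_comp _ hdP hdΨ]
      rfl
    -- `ρ` at the point
    have hρy : ρ (uncurry D.toFun (Ψ (x, l₁ * l))) =
        (l₁ * l) * (Uθ (x, l₁ * l) * r (Ψ (x, l₁ * l))) := by
      have h1 := hr (Ψ (x, l₁ * l)).1 (Ψ (x, l₁ * l)).2 (le_of_lt hy.2)
      rw [Prod.mk.eta] at h1
      rw [h1, hΨ2]
      ring
    have hI := helper_innerMfderivInteriorInverse D g gb j hj.contMDiff ρ hjg P hjP hy (hκρ _ hy) hdP
      (mfderiv ((𝓡 4).prod 𝓘(ℝ, ℝ)) ((𝓡 4).prod 𝓘(ℝ, ℝ)) Ψ (x, l₁ * l) (v, l₁ * s))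
    rw [hdΦ, hΦmk]
    refine hI.trans ?_
    rw [hρy]
    exact div_mul_sq _ _ _
  /- ### Conclusion: `c = 1`, `κ₀ = 1 / l₁²` -/
  refine ⟨1, 1 / l₁ ^ 2, Φ, one_pos, one_div_pos.2 (pow_pos hl₁ 2), hΦsm, hΦinj, hΦco, ?_⟩
  intro ε hε
  obtain ⟨t, ht, hQt⟩ := hE ε hε
  refine ⟨min (t / l₁) (1 / 2), ⟨lt_min (div_pos ht hl₁) (by norm_num),
    (min_le_right _ _).trans_lt (by norm_num)⟩, ?_⟩
  intro x l hl v s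
  have hl1 : l ∈ Ioo (0 : ℝ) 1 :=
    ⟨hl.1, hl.2.trans_le ((min_le_right _ _).trans (by norm_num))⟩
  have hμt : l₁ * l ∈ Ioo (0 : ℝ) t := by
    refine ⟨mul_pos hl₁ hl.1, ?_⟩
    have := hl.2.trans_le (min_le_left _ _)
    rwa [lt_div_iff₀ hl₁, mul_comm] at this
  rw [hmetric x l hl1 v s]
  have hb := hQt x (l₁ * l) hμt v (l₁ * s)
  have hμ2 : 0 < (l₁ * l) ^ 2 := pow_pos (mul_pos hl₁ hl.1) 2
  rw [rescale_identity (g₀.inner x v v) hl₁.ne' hl.1.ne', ← sub_div, abs_div, abs_of_pos hμ2,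
    mul_div_assoc']
  exact div_le_div_of_nonneg_right hb hμ2.le

end Summit.SmoothPoincare4.SmoothPoincare4.Cruxes.AhHadamardFilling.EinsteinBulkTransfer

end
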